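import Summits.QuantumAdvantage.QuantumAdvantage.Theorems.NearExactIsExact.Negative.CornerFlatRankFourCeiling

/-!
# Corner-flat pairs of rank 4 (imbalance-4 almost-MM habitat AMM₂), III: cubic form of the ceiling, coordinate halves

Negative-side (disprover lane, unit `b2b-cforr-disprove-g33`, 2026-08-23) sequel of
`Negative/CornerFlatRankFourCeiling.lean` for the crux `CubicForrelation.NearExactIsExact`: the Plücker
hypothesis of `cfr_forrelation_le_fifteen_sixteenths` is discharged from CUBICITY of `f`.

* `cfr_l_zero`, `cfr_l_single`, `cfr_l_pair` — values of a dot-product function at `0`, `eᵢ`, `eᵢ ⊕ eⱼ`.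
* `cfr_deg_polar` — `AmmCeilingX.acx_deg_polar` for a second block of any size: for cubic `f` the restricted
  second `x₂`-derivative `x₁ ↦ f(x₁‖0) ⊕ f(x₁‖s) ⊕ f(x₁‖t) ⊕ f(x₁‖s⊕t)` is affine.
* `cfr_pluecker_affine_of_cubic` — hence the Plücker 2-vector `B(x₁) = u₁∧u₂ ⊕ u₃∧u₄` of a cubic rank-4
  corner-flat `f` is coordinatewise affine.
* `cfr_forrelation_le_fifteen_sixteenths_of_cubic` — `f`, `h` cubic, `u₂` coordinatewise affine, one fibre
  with odd eight-corner sum over `w + span(u₂,u₃,u₄)` ⇒ `Φ(f,g) ≤ 15/16`; `cfr_window_isotropic_of_cubic` is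
  the contrapositive.
* `cfr_half_dual_even`, `cfr_fibre_sum_le_twelve_of_halves` — FRAME-FREE fibre input for
  `cfr_forrelation_le_of_bad_fibres`: if `h` has odd parity on both coordinate halves `{q : (corner q)_l = c}`
  of a fibre, the fibre carries two mismatches (corner sum `≤ 12`).  (The matching degree-`2` witness — the
  half parity equals `Σ_S c_S · (B_ij B_kl ⊕ B_ik B_jl ⊕ B_il B_jk)` over the cubic monomials `S = {i,j,k}`
  of `h` — is left to a sequel; the identity is brute-force checked in the unit's notes.)

Standard three axioms only.
-/

set_option linter.dupNamespace false -- D-0017: single-problem summit ⇒ `QuantumAdvantage.QuantumAdvantage` by design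

noncomputable section

namespace Summit.QuantumAdvantage.QuantumAdvantage.Theorems.NearExactIsExact.Negative.CornerFlatRankFour

open Finset
open Literature.Computability.QuantumComplexity
open Literature.Computability.QuantumComplexity.BuzetChailloux (bxor zeroVec twist_bxor_right
  twist_zeroVec_right bxor_eq_zeroVec_iff sum_twist_left zeroVec_bxor bxor_comm)
open Literature.Computability.QuantumComplexity.DerivativeWalsh (W)
open Summit.QuantumAdvantage.QuantumAdvantage.Theorems.CubicForrelation.NearExactIsExact
open Summit.QuantumAdvantage.QuantumAdvantage.Theorems.NearExactIsExact.Negative.SkewProductCore (ind ind_xor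
  ind_true ind_false)

variable {a m k : ℕ}

section Cubic

/-! ### The Plücker hypothesis follows from cubicity of `f` -/

variable (l : (Fin k → Bool) → (Fin k → Bool) → Bool)

/-- A dot-product function vanishes at `0`: `l y 0 = 0`. [folklore] -/
theorem cfr_l_zero (hl : ∀ y x, signOf (l y x) = twist x y) (y : Fin k → Bool) : l y zeroVec = false :=
  acq_signOf_inj _ _ (by rw [hl, twist_comm, twist_zeroVec_right, SgnForrMem.signOf_false])

/-- `l y eᵢ = yᵢ`. [folklore] -/
theorem cfr_l_single (hl : ∀ y x, signOf (l y x) = twist x y) (y : Fin k → Bool) (i : Fin k) :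
    l y (Pi.single i true) = y i :=
  acq_signOf_inj _ _ (by rw [hl, fc_twist_single])

/-- `l y (eᵢ ⊕ eⱼ) = yᵢ ⊕ yⱼ`. [folklore] -/
theorem cfr_l_pair (hl : ∀ y x, signOf (l y x) = twist x y) (y : Fin k → Bool) (i j : Fin k) :
    l y (bxor (Pi.single i true) (Pi.single j true)) = (y i ^^ y j) :=
  acq_signOf_inj _ _ (by
    rw [hl, twist_comm, twist_bxor_right, twist_comm y, twist_comm y, fc_twist_single, fc_twist_single,
      signOf_xor])

/-- **Polar entries are affine in `x₁`** (`acx_deg_polar` for a second block of any size `m`): for cubic `f`,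
`x₁ ↦ f(x₁‖0) ⊕ f(x₁‖s) ⊕ f(x₁‖t) ⊕ f(x₁‖s⊕t)` has degree `≤ 1`. [cite: Carlet2020, §2.2] -/
theorem cfr_deg_polar {f : (Fin (a + m) → Bool) → Bool} (hf : IsDegLeFun 3 f) (s t : Fin m → Bool) :
    IsDegLeFun 1 (fun x₁ : Fin a → Bool => f (Fin.append x₁ zeroVec) ^^ f (Fin.append x₁ s) ^^
      f (Fin.append x₁ t) ^^ f (Fin.append x₁ (bxor s t))) := by
  have h2 : IsDegLeFun 2 (fun x => f x ^^ f (bxor x (Fin.append zeroVec s))) :=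
    stub_derivDegree _ 2 f (Fin.append zeroVec s) hf
  have h1 : IsDegLeFun 1 (fun x => (f x ^^ f (bxor x (Fin.append zeroVec s))) ^^
      (f (bxor x (Fin.append zeroVec t)) ^^ f (bxor (bxor x (Fin.append zeroVec t)) (Fin.append zeroVec s)))) :=
    stub_derivDegree _ 1 _ (Fin.append zeroVec t) h2
  have key := acx_deg_eval h1 (zeroVec : Fin m → Bool)
  refine rm_isDegLeFun_congr key fun x₁ => ?_
  simp only [acx_bxor_append_zero, zeroVec_bxor, bxor_comm t s]
  cases f (Fin.append x₁ zeroVec) <;> cases f (Fin.append x₁ s) <;> cases f (Fin.append x₁ t) <;>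
    cases f (Fin.append x₁ (bxor s t)) <;> rfl

/-- **The Plücker 2-vector of a cubic rank-4 corner-flat `f` is affine**: `x₁ ↦ B(x₁)_{ij} =
(u₁∧u₂ ⊕ u₃∧u₄)(x₁)_{ij} = f(x₁‖0) ⊕ f(x₁‖eᵢ) ⊕ f(x₁‖eⱼ) ⊕ f(x₁‖eᵢ⊕eⱼ)` has degree `≤ 1`
(`cfr_deg_polar`). [cite: Carlet2020, §2.2] -/
theorem cfr_pluecker_affine_of_cubic (l : (Fin (a + 4) → Bool) → (Fin (a + 4) → Bool) → Bool)
    (hl : ∀ y x, signOf (l y x) = twist x y)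
    (u₁ u₂ u₃ u₄ w : (Fin a → Bool) → (Fin (a + 4) → Bool)) (f₀ : (Fin a → Bool) → Bool)
    (f : (Fin (a + (a + 4)) → Bool) → Bool)
    (hf : ∀ x₁ x₂, f (Fin.append x₁ x₂) =
      ((l (u₁ x₁) x₂ && l (u₂ x₁) x₂) ^^ (l (u₃ x₁) x₂ && l (u₄ x₁) x₂) ^^ l (w x₁) x₂ ^^ f₀ x₁))
    (hfc : IsDegLeFun 3 f) (i j : Fin (a + 4)) :
    IsDegLeFun 1 (fun x =>
      ((u₁ x i && u₂ x j) ^^ (u₁ x j && u₂ x i)) ^^ ((u₃ x i && u₄ x j) ^^ (u₃ x j && u₄ x i))) := by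
  refine rm_isDegLeFun_congr (cfr_deg_polar hfc (Pi.single i true) (Pi.single j true)) fun x => ?_
  rw [hf, hf, hf, hf]
  simp only [cfr_l_zero l hl, cfr_l_single l hl, cfr_l_pair l hl]
  cases u₁ x i <;> cases u₁ x j <;> cases u₂ x i <;> cases u₂ x j <;> cases u₃ x i <;> cases u₃ x j <;>
    cases u₄ x i <;> cases u₄ x j <;> cases w x i <;> cases w x j <;> cases f₀ x <;> rfl

/-- **`Φ ≤ 15/16` off the isotropic sub-habitat — cubic form.**  In the rank-4 corner-flat family, if `f`
and `h` are CUBIC, the frame vector `u₂` is coordinatewise affine, and one fibre has odd eight-corner sum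
over `w + span(u₂,u₃,u₄)`, then `Φ(f,g) ≤ 15/16` (`cfr_pluecker_affine_of_cubic` + `cfr_minor_deg` +
`cfr_forrelation_le_fifteen_sixteenths`).  [folklore] -/
theorem cfr_forrelation_le_fifteen_sixteenths_of_cubic
    (l : (Fin (a + 4) → Bool) → (Fin (a + 4) → Bool) → Bool) (hl : ∀ y x, signOf (l y x) = twist x y)
    (u₁ u₂ u₃ u₄ w : (Fin a → Bool) → (Fin (a + 4) → Bool)) (f₀ : (Fin a → Bool) → Bool)
    (φ : (Fin (a + 4) → Bool) → (Fin a → Bool)) (h : (Fin (a + 4) → Bool) → Bool)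
    (f g : (Fin (a + (a + 4)) → Bool) → Bool)
    (hf : ∀ x₁ x₂, f (Fin.append x₁ x₂) =
      ((l (u₁ x₁) x₂ && l (u₂ x₁) x₂) ^^ (l (u₃ x₁) x₂ && l (u₄ x₁) x₂) ^^ l (w x₁) x₂ ^^ f₀ x₁))
    (hg : ∀ (y₁ : Fin a → Bool) (y₂ : Fin (a + 4) → Bool),
      signOf (g (Fin.append y₁ y₂)) = twist y₁ (φ y₂) * signOf (h y₂))
    (corner : (Fin a → Bool) → (Bool × Bool) × (Bool × Bool) → (Fin (a + 4) → Bool))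
    (hc : ∀ x₁ q j, corner x₁ q j =
      (w x₁ j ^^ (q.1.1 && u₁ x₁ j) ^^ (q.1.2 && u₂ x₁ j) ^^ (q.2.1 && u₃ x₁ j) ^^ (q.2.2 && u₄ x₁ j)))
    (hφ : ∀ x₁ q, φ (corner x₁ q) = x₁) (hinj : ∀ x₁, Function.Injective (corner x₁))
    (hfc : IsDegLeFun 3 f) (hh : IsDegLeFun 3 h) (hu₂ : ∀ j, IsDegLeFun 1 (fun x => u₂ x j))
    (hone : ∃ x₀ : Fin a → Bool,
      (((h (w x₀) ^^ h (bxor (w x₀) (u₄ x₀))) ^^ (h (bxor (w x₀) (u₃ x₀)) ^^ h (bxor (bxor (w x₀) (u₃ x₀)) (u₄ x₀)))) ^^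
        ((h (bxor (w x₀) (u₂ x₀)) ^^ h (bxor (bxor (w x₀) (u₂ x₀)) (u₄ x₀))) ^^ (h (bxor (bxor (w x₀) (u₂ x₀)) (u₃ x₀)) ^^ h (bxor (bxor (bxor (w x₀) (u₂ x₀)) (u₃ x₀)) (u₄ x₀))))) = true) :
    forrelation f g ≤ 15 / 16 :=
  cfr_forrelation_le_fifteen_sixteenths l hl u₁ u₂ u₃ u₄ w f₀ φ h f g hf hg corner hc hφ hinj hh
    (fun i j k _ _ _ => cfr_minor_deg
      (fun i' j' => cfr_pluecker_affine_of_cubic l hl u₁ u₂ u₃ u₄ w f₀ f hf hfc i' j') hu₂ i j k) hone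

/-- Contrapositive in cubic form, for planners: a rank-4 corner-flat pair with `f`, `h` cubic, `u₂`
coordinatewise affine and `Φ(f,g) > 15/16` has vanishing eight-corner sums over `w(x₁) + span(u₂,u₃,u₄)(x₁)`
at EVERY `x₁` (the cubic part of `h` is isotropic along `span(u₂,u₃,u₄)` on every fibre). [folklore] -/
theorem cfr_window_isotropic_of_cubic
    (l : (Fin (a + 4) → Bool) → (Fin (a + 4) → Bool) → Bool) (hl : ∀ y x, signOf (l y x) = twist x y)
    (u₁ u₂ u₃ u₄ w : (Fin a → Bool) → (Fin (a + 4) → Bool)) (f₀ : (Fin a → Bool) → Bool)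
    (φ : (Fin (a + 4) → Bool) → (Fin a → Bool)) (h : (Fin (a + 4) → Bool) → Bool)
    (f g : (Fin (a + (a + 4)) → Bool) → Bool)
    (hf : ∀ x₁ x₂, f (Fin.append x₁ x₂) =
      ((l (u₁ x₁) x₂ && l (u₂ x₁) x₂) ^^ (l (u₃ x₁) x₂ && l (u₄ x₁) x₂) ^^ l (w x₁) x₂ ^^ f₀ x₁))
    (hg : ∀ (y₁ : Fin a → Bool) (y₂ : Fin (a + 4) → Bool),
      signOf (g (Fin.append y₁ y₂)) = twist y₁ (φ y₂) * signOf (h y₂))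
    (corner : (Fin a → Bool) → (Bool × Bool) × (Bool × Bool) → (Fin (a + 4) → Bool))
    (hc : ∀ x₁ q j, corner x₁ q j =
      (w x₁ j ^^ (q.1.1 && u₁ x₁ j) ^^ (q.1.2 && u₂ x₁ j) ^^ (q.2.1 && u₃ x₁ j) ^^ (q.2.2 && u₄ x₁ j)))
    (hφ : ∀ x₁ q, φ (corner x₁ q) = x₁) (hinj : ∀ x₁, Function.Injective (corner x₁))
    (hfc : IsDegLeFun 3 f) (hh : IsDegLeFun 3 h) (hu₂ : ∀ j, IsDegLeFun 1 (fun x => u₂ x j))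
    (hwin : 15 / 16 < forrelation f g) (x₁ : Fin a → Bool) :
    (((h (w x₁) ^^ h (bxor (w x₁) (u₄ x₁))) ^^ (h (bxor (w x₁) (u₃ x₁)) ^^ h (bxor (bxor (w x₁) (u₃ x₁)) (u₄ x₁)))) ^^
        ((h (bxor (w x₁) (u₂ x₁)) ^^ h (bxor (bxor (w x₁) (u₂ x₁)) (u₄ x₁))) ^^ (h (bxor (bxor (w x₁) (u₂ x₁)) (u₃ x₁)) ^^ h (bxor (bxor (bxor (w x₁) (u₂ x₁)) (u₃ x₁)) (u₄ x₁))))) = false :=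
  Bool.eq_false_iff.mpr fun hx => absurd hwin (not_lt.mpr (cfr_forrelation_le_fifteen_sixteenths_of_cubic
    l hl u₁ u₂ u₃ u₄ w f₀ φ h f g hf hg corner hc hφ hinj hfc hh hu₂ ⟨x₁, hx⟩))

end Cubic

section Half

/-! ### Two mismatches from odd half-fibre parities (halves cut out by a coordinate)

Frame-free form of `cfr_fibre_sum_le_twelve`, for the successor's intrinsic isotropy ceiling: the halves
of a fibre are `{q : (corner q)_l = c}`, `c = 0, 1` — an affine hyperplane pair of the corner cube when the
frame is not inside `ker e_l`, everything/nothing otherwise — and parities are `ZMod 2`-sums of `ind`. -/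

/-- The dual quadratic `e ⊕ q₁₁q₁₂ ⊕ q₂₁q₂₂` has even weight on each coordinate half
`{q : w_l ⊕ q₁₁α₁ ⊕ q₁₂α₂ ⊕ q₂₁α₃ ⊕ q₂₂α₄ = c}` of the corner cube (`2⁷` cases, `decide`). [folklore] -/
theorem cfr_half_dual_even (wl α₁ α₂ α₃ α₄ c e : Bool) :
    (∑ q ∈ (univ : Finset ((Bool × Bool) × (Bool × Bool))).filter
        (fun q => (wl ^^ (q.1.1 && α₁) ^^ (q.1.2 && α₂) ^^ (q.2.1 && α₃) ^^ (q.2.2 && α₄)) = c),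
      (ind e + ind (q.1.1 && q.1.2) + ind (q.2.1 && q.2.2))) = 0 := by
  rw [sum_filter]
  simp only [Fintype.sum_prod_type, Fintype.sum_bool]
  cases wl <;> cases α₁ <;> cases α₂ <;> cases α₃ <;> cases α₄ <;> cases c <;> cases e <;> decide

/-- **Two mismatches from odd half-parities.**  On a 16-corner fibre parametrised by `cx` (corner map of a
rank-4 corner-flat pair, `cfr_corner_eq`), fix a coordinate `l`; if `h` has ODD parity on each half
`{q : (cx q)_l = c}`, `c = 0, 1`, then each half contains a mismatch against the dual quadratic
(`cfr_half_dual_even`), the two mismatches are distinct, and the signed corner sum is `≤ 12`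
(`cfr_sum_signOf_le`).  This is the fibre input of `cfr_forrelation_le_of_bad_fibres` for witnesses `E`
built from the Pfaffian coordinates `e_l ⌟ γ₂(B)`. [folklore] -/
theorem cfr_fibre_sum_le_twelve_of_halves (h : (Fin m → Bool) → Bool)
    (cx : (Bool × Bool) × (Bool × Bool) → (Fin m → Bool)) (e : Bool) (l : Fin m)
    (wl α₁ α₂ α₃ α₄ : Bool)
    (hl : ∀ q, cx q l = (wl ^^ (q.1.1 && α₁) ^^ (q.1.2 && α₂) ^^ (q.2.1 && α₃) ^^ (q.2.2 && α₄)))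
    (hodd : ∀ c : Bool, (∑ q ∈ univ.filter (fun q => cx q l = c), ind (h (cx q))) = 1) :
    ∑ q, signOf (h (cx q) ^^ e ^^ (q.1.1 && q.1.2) ^^ (q.2.1 && q.2.2)) ≤ 12 := by
  classical
  -- each half contains a mismatch
  have hex : ∀ c : Bool, ∃ q : (Bool × Bool) × (Bool × Bool), cx q l = c ∧
      (h (cx q) ^^ e ^^ (q.1.1 && q.1.2) ^^ (q.2.1 && q.2.2)) = true := by
    intro c
    by_contra hno
    push Not at hno
    have hzero : (∑ q ∈ univ.filter (fun q => cx q l = c),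
        ind (h (cx q) ^^ e ^^ (q.1.1 && q.1.2) ^^ (q.2.1 && q.2.2))) = 0 :=
      sum_eq_zero fun q hq => by
        rw [Bool.eq_false_iff.mpr (hno q (mem_filter.mp hq).2), ind_false]
    have heven := cfr_half_dual_even wl α₁ α₂ α₃ α₄ c e
    have hfl : (univ.filter fun q : (Bool × Bool) × (Bool × Bool) =>
        (wl ^^ (q.1.1 && α₁) ^^ (q.1.2 && α₂) ^^ (q.2.1 && α₃) ^^ (q.2.2 && α₄)) = c) =
        univ.filter fun q => cx q l = c :=
      filter_congr fun q _ => by rw [hl]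
    rw [hfl] at heven
    simp only [ind_xor, sum_add_distrib] at hzero heven
    rw [hodd c] at hzero
    have h10 : (1 : ZMod 2) = 0 := by linear_combination hzero - heven
    exact absurd h10 (by decide)
  obtain ⟨q₀, hq₀, k₀⟩ := hex false
  obtain ⟨q₁, hq₁, k₁⟩ := hex true
  have hne : q₀ ≠ q₁ := by
    rintro rfl
    rw [hq₀] at hq₁
    exact Bool.false_ne_true hq₁
  have key := cfr_sum_signOf_le
    (fun q : (Bool × Bool) × (Bool × Bool) => h (cx q) ^^ e ^^ (q.1.1 && q.1.2) ^^ (q.2.1 && q.2.2))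
    q₀ q₁ hne k₀ k₁
  have h16 : (Fintype.card ((Bool × Bool) × (Bool × Bool)) : ℝ) - 4 ≤ 12 := by
    norm_num [Fintype.card_prod, Fintype.card_bool]
  exact key.trans h16

end Half

end Summit.QuantumAdvantage.QuantumAdvantage.Theorems.NearExactIsExact.Negative.CornerFlatRankFour

end
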